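import Mathlib
import Literature.NumberTheory.EllipticCurves.KleinJIntegralQExpansion
import Summits.Langlands.Langlands.Theorems.CapacityClassicalityHilbertIntegralOverconvergentIsCongruenceStubCoeffInvBound
import Summits.Langlands.Langlands.Theorems.CapacityClassicalityHilbertIntegralOverconvergentIsCongruenceStubCoeffMulBound
import Summits.Langlands.Langlands.Theorems.CapacityClassicalityHilbertIntegralOverconvergentIsCongruenceStubEisensteinCoeff

/-!
# Katz–Sturm: Sturm's bound is the `p`-adic capacity (stub `stub_katzSturm`, line `Sketch`)

Registered stub `stub_katzSturm` of the line `Sketch` for the crux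
`Summit.Langlands.Langlands.Theses.CapacityClassicality.IntegralOverconvergentIsCongruence`
(item stmt-Langlands-8457).  **K1, the `p`-adic gain:** for a prime `p ≥ 5`, `ι : ℚ̄_p ≃+* ℂ` and a
complex `q`-series `F = ∑ᵢ cᵢ E_{p-1}^{-i}` (coefficientwise along `ι⁻¹`) carrying a Katz datum of
weight `w`, rate `r > 0`, constant `C ≥ 0` on `Γ₁(N)` (`cᵢ ∈ M_{w+i(p-1)}(Γ₁(N))`,
`‖ι⁻¹ aₙ(cᵢ)‖ ≤ C p^{-ri}`) with `a_m(F) = 0` for `m < M`, one has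
`‖ι⁻¹ a_M(F)‖ ≤ C · p^{(r/(p-1))(w + 12 - 12(M+1)/μ)}`, `μ = [SL₂(ℤ) : Γ₁(N)]`, granted the sup-norm
Sturm bound `hSup` along `ι` for cusp forms on `Γ₁(N)` (neighbouring stub `stub_supNormOfSturm`).

Proof, read in `ℚ̄_p⟦q⟧` through `PowerSeries.map ι⁻¹`: `E_{p-1}` is `p`-integral with constant
term `1` (von Staudt–Clausen, the tree's `stub_eisensteinCoeff`), hence so are `E_{p-1}^{±j}`;
`Δ = q + O(q²) ∈ ℤ⟦q⟧` (`qExpansion_discriminant`).  For every `I`,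
`F Δ E_{p-1}^I = G_I + tail`, `G_I = Δ ∑_{i ≤ I} cᵢ E_{p-1}^{I-i}` a cusp form of weight
`12 + (w + I(p-1))` on `Γ₁(N)`, `‖tail‖ ≤ C p^{-r(I+1)}` coefficientwise, and
`F Δ E^I = q^{M+1}(a_M(F) + O(q))` (`katz_truncation`).  With `J` least such that
`12(M+1) ≤ (12 + w + J(p-1)) μ`: if `J = 0` the trivial bound `‖a_M(F)‖ ≤ C` suffices, else `hSup`
applied to `G_{J-1}` with `ε = C p^{-rJ}` gives `‖ι⁻¹ a_M(F)‖ ≤ C p^{-rJ}`, and `-rJ` is at most the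
stated exponent.  No new definitions, no named facts.  References: N. M. Katz, LNM 350 (1973), §2;
J. Sturm, LNM 1240 (1987), Thm. 1.
-/

set_option linter.dupNamespace false -- project-wide option (lakefile weak.linter.dupNamespace); `Summit.Langlands.Langlands` is the mandated namespace

open scoped MatrixGroups Manifold Topology
open UpperHalfPlane CongruenceSubgroup Metric PowerSeries
open Literature.NumberTheory.EllipticCurves Literature.NumberTheory.EllipticCurves.ModularForms
open Summit.Langlands.Langlands.Theorems.HilbertIntegralOverconvergentIsCongruence

noncomputable section

namespace Summit.Langlands.Langlands.Theorems.CapacityClassicality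

section Ultrametric

variable {K : Type*} [NormedField K]

/-- Coefficientwise convergent sums of power series may be multiplied by a fixed power series:
if `∑ᵢ aᵢ = G` coefficientwise then `∑ᵢ aᵢ Q = G Q` coefficientwise (each coefficient of a
product is a finite sum). [folklore] -/
theorem hasSum_coeff_mul {a : ℕ → PowerSeries K} {G : PowerSeries K}
    (h : ∀ n, HasSum (fun i ↦ coeff n (a i)) (coeff n G)) (Q : PowerSeries K) (n : ℕ) :
    HasSum (fun i ↦ coeff n (a i * Q)) (coeff n (G * Q)) := by
  simp only [coeff_mul]
  exact hasSum_sum fun x _ ↦ (h x.1).mul_right _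

variable [IsUltrametricDist K]

/-- Powers of a power series with coefficients of norm `≤ 1` have coefficients of norm `≤ 1`
(ultrametric product rule). [folklore] -/
theorem norm_coeff_pow_le_one {φ : PowerSeries K} (h : ∀ n, ‖coeff n φ‖ ≤ 1) (k n : ℕ) :
    ‖coeff n (φ ^ k)‖ ≤ 1 := by
  induction k generalizing n with
  | zero => rw [pow_zero, coeff_one]; split_ifs <;> simp
  | succ k ih =>
    simpa only [pow_succ, mul_one] using
      norm_coeff_mul_le_of_forall_le (φ ^ k) φ zero_le_one zero_le_one ih h n

/-- Ultrametric bound for the sum of a convergent series all of whose terms have norm `≤ C`.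
[folklore] -/
theorem norm_le_of_hasSum {f : ℕ → K} {a : K} {C : ℝ} (hf : HasSum f a) (hC : 0 ≤ C)
    (h : ∀ i, ‖f i‖ ≤ C) : ‖a‖ ≤ C := by
  rw [← hf.tsum_eq]
  exact IsUltrametricDist.norm_tsum_le_of_forall_le_of_nonneg hC h

/-- The trivial bound for a Katz expansion: if `G = ∑ᵢ aᵢ e^{-i}` coefficientwise with `e`
integral of constant term `1` and `‖aᵢ‖ ≤ Bᵢ` coefficientwise, `B` antitone, then every
coefficient of `G` has norm `≤ B₀`. [folklore] -/
theorem norm_coeff_le_of_hasSum {e G : PowerSeries K} {a : ℕ → PowerSeries K} {B : ℕ → ℝ}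
    (he0 : constantCoeff e = 1) (he : ∀ n, ‖coeff n e‖ ≤ 1)
    (hB0 : ∀ i, 0 ≤ B i) (hB : Antitone B) (ha : ∀ i n, ‖coeff n (a i)‖ ≤ B i)
    (hG : ∀ n, HasSum (fun i ↦ coeff n (a i * e⁻¹ ^ i)) (coeff n G)) (n : ℕ) :
    ‖coeff n G‖ ≤ B 0 :=
  norm_le_of_hasSum (hG n) (hB0 0) fun i ↦ by
    calc ‖coeff n (a i * e⁻¹ ^ i)‖ ≤ B i * 1 :=
          norm_coeff_mul_le_of_forall_le _ _ (hB0 i) zero_le_one (ha i)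
            (norm_coeff_pow_le_one (norm_coeff_inv_le_one e he0 he) i) n
      _ ≤ B 0 := by rw [mul_one]; exact hB (Nat.zero_le i)

/-- **Katz truncation.** Let `e` be an integral power series with constant term `1`, `δ` an
integral power series with `δ = q + O(q²)`, `G = ∑ᵢ aᵢ e^{-i}` coefficientwise with
`‖aᵢ‖ ≤ Bᵢ` (coefficientwise, `B ≥ 0` antitone) and `G = O(q^M)`.  Then for every `I`, the
truncation `S_I = δ ∑_{i ≤ I} aᵢ e^{I-i}` satisfies `‖coeff m S_I‖ ≤ B_{I+1}` for `m ≤ M` and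
`‖coeff M G - coeff (M+1) S_I‖ ≤ B_{I+1}`: indeed `G δ e^I = S_I + ∑_{i > I} aᵢ δ e^{-(i-I)}`,
the tail is coefficientwise `≤ B_{I+1}` (ultrametric), and `G δ e^I = q^{M+1}(a_M(G) + O(q))`.
[folklore] -/
theorem katz_truncation {e δ G : PowerSeries K} {a : ℕ → PowerSeries K} {B : ℕ → ℝ} {M : ℕ}
    (he0 : constantCoeff e = 1) (he : ∀ n, ‖coeff n e‖ ≤ 1)
    (hδ : ∀ n, ‖coeff n δ‖ ≤ 1) (hδ0 : coeff 0 δ = 0) (hδ1 : coeff 1 δ = 1)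
    (hB0 : ∀ i, 0 ≤ B i) (hB : Antitone B) (ha : ∀ i n, ‖coeff n (a i)‖ ≤ B i)
    (hG : ∀ n, HasSum (fun i ↦ coeff n (a i * e⁻¹ ^ i)) (coeff n G))
    (hM : ∀ m, m < M → coeff m G = 0) (I : ℕ) :
    (∀ m, m ≤ M →
      ‖coeff m (δ * ∑ i ∈ Finset.range (I + 1), a i * e ^ (I - i))‖ ≤ B (I + 1)) ∧
    ‖coeff M G - coeff (M + 1) (δ * ∑ i ∈ Finset.range (I + 1), a i * e ^ (I - i))‖ ≤
      B (I + 1) := by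
  set S := ∑ i ∈ Finset.range (I + 1), a i * e ^ (I - i) with hS
  have he0' : constantCoeff e ≠ 0 := by rw [he0]; exact one_ne_zero
  have hu : ∀ n, ‖coeff n e⁻¹‖ ≤ 1 := norm_coeff_inv_le_one e he0 he
  have hue : e⁻¹ * e = 1 := PowerSeries.inv_mul_cancel e he0'
  -- multiply the expansion by `δ e^I` and split it at `I + 1`
  have h2 : ∀ n, HasSum (fun j ↦ coeff n (a (j + (I + 1)) * e⁻¹ ^ (j + (I + 1)) * (δ * e ^ I)))
      (coeff n (G * (δ * e ^ I)) -
        ∑ i ∈ Finset.range (I + 1), coeff n (a i * e⁻¹ ^ i * (δ * e ^ I))) :=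
    fun n ↦ (hasSum_nat_add_iff' (I + 1)).mpr (hasSum_coeff_mul hG _ n)
  have h3 : ∀ n, ∑ i ∈ Finset.range (I + 1), coeff n (a i * e⁻¹ ^ i * (δ * e ^ I)) =
      coeff n (δ * S) := by
    intro n
    rw [← map_sum, hS, Finset.mul_sum]
    congr 1
    refine Finset.sum_congr rfl fun i hi ↦ ?_
    have hi' : i ≤ I := Nat.lt_succ_iff.mp (Finset.mem_range.mp hi)
    calc a i * e⁻¹ ^ i * (δ * e ^ I) = δ * (a i * (e⁻¹ * e) ^ i * e ^ (I - i)) := by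
          rw [← pow_sub_mul_pow e hi', mul_pow]; ring
      _ = δ * (a i * e ^ (I - i)) := by rw [hue, one_pow, mul_one]
  have h4 : ∀ j, a (j + (I + 1)) * e⁻¹ ^ (j + (I + 1)) * (δ * e ^ I) =
      a (j + (I + 1)) * e⁻¹ ^ (j + 1) * δ := by
    intro j
    calc a (j + (I + 1)) * e⁻¹ ^ (j + (I + 1)) * (δ * e ^ I)
        = a (j + (I + 1)) * e⁻¹ ^ (j + 1) * δ * (e⁻¹ * e) ^ I := by rw [mul_pow]; ring
      _ = a (j + (I + 1)) * e⁻¹ ^ (j + 1) * δ := by rw [hue, one_pow, mul_one]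
  have h5 : ∀ n j, ‖coeff n (a (j + (I + 1)) * e⁻¹ ^ (j + 1) * δ)‖ ≤ B (I + 1) := by
    intro n j
    calc ‖coeff n (a (j + (I + 1)) * e⁻¹ ^ (j + 1) * δ)‖ ≤ B (j + (I + 1)) * 1 * 1 :=
          norm_coeff_mul_le_of_forall_le _ _ (mul_nonneg (hB0 _) zero_le_one) zero_le_one
            (norm_coeff_mul_le_of_forall_le _ _ (hB0 _) zero_le_one (ha _)
              (norm_coeff_pow_le_one hu _)) hδ n
      _ = B (j + (I + 1)) := by ring
      _ ≤ B (I + 1) := hB (Nat.le_add_left _ _)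
  have h6 : ∀ n, ‖coeff n (G * (δ * e ^ I)) - coeff n (δ * S)‖ ≤ B (I + 1) := by
    intro n
    have h := h2 n
    rw [h3 n] at h
    simp_rw [h4] at h
    exact norm_le_of_hasSum h (hB0 _) (h5 n)
  -- `G δ e^I = q^{M+1} · (a_M(G) + O(q))`
  obtain ⟨G₁, hG₁⟩ : X ^ M ∣ G := PowerSeries.X_pow_dvd_iff.mpr hM
  obtain ⟨δ₁, hδ₁⟩ : X ∣ δ := X_dvd_iff.mpr (by rwa [← coeff_zero_eq_constantCoeff_apply])
  have h7 : G * (δ * e ^ I) = X ^ (M + 1) * (G₁ * δ₁ * e ^ I) := by rw [hG₁, hδ₁]; ring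
  have h8 : ∀ m, m ≤ M → coeff m (G * (δ * e ^ I)) = 0 := fun m hm ↦ by
    rw [h7, coeff_X_pow_mul', if_neg (by omega)]
  have hG₁' : coeff M G = constantCoeff G₁ := by
    rw [hG₁, coeff_X_pow_mul', if_pos le_rfl, Nat.sub_self, coeff_zero_eq_constantCoeff_apply]
  have hδ₁' : constantCoeff δ₁ = 1 := by
    rw [← hδ1, hδ₁, ← pow_one (X : PowerSeries K), coeff_X_pow_mul', if_pos le_rfl, Nat.sub_self,
      coeff_zero_eq_constantCoeff_apply]
  have h9 : coeff (M + 1) (G * (δ * e ^ I)) = coeff M G := by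
    rw [h7, coeff_X_pow_mul', if_pos le_rfl, Nat.sub_self, coeff_zero_eq_constantCoeff_apply,
      map_mul, map_mul, map_pow, he0, one_pow, mul_one, hδ₁', mul_one, hG₁']
  refine ⟨fun m hm ↦ ?_, ?_⟩
  · have h := h6 m
    rwa [h8 m hm, zero_sub, norm_neg] at h
  · have h := h6 (M + 1)
    rwa [h9] at h

end Ultrametric

section ModularForms

variable {N : ℕ} [NeZero N]

/-- **Katz truncations are classical** (adapted from the tree's `stub_katzTruncationModular`).
If `c i` is the `q`-expansion of a modular form of weight `k + i(p-1)` on `Γ₁(N)` for every `i`,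
then `∑_{i ≤ I} c_i · E_{p-1}^{I-i}` is the `q`-expansion of a modular form of weight
`k + I(p-1)` on `Γ₁(N)` (`E_{p-1}` restricted from level one; induction on `I`). [folklore] -/
theorem exists_modularForm_truncation {p : ℕ} (hp : 3 ≤ p - 1) (k : ℤ) (c : ℕ → PowerSeries ℂ)
    (hc : ∀ i : ℕ, ∃ F : ModularForm (Gamma1 N) (k + i * (p - 1 : ℕ)), c i = qExpansion 1 ⇑F)
    (I : ℕ) :
    ∃ T : ModularForm (Gamma1 N) (k + I * (p - 1 : ℕ)),
      qExpansion 1 ⇑T =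
        ∑ i ∈ Finset.range (I + 1), c i * (qExpansion 1 ⇑(ModularForm.E hp)) ^ (I - i) := by
  have hΓ : (1 : ℝ) ∈ (Gamma1 N : Subgroup (GL (Fin 2) ℝ)).strictPeriods := by simp
  have hle : (Gamma1 N : Subgroup (GL (Fin 2) ℝ)) ≤ 𝒮ℒ := by rintro _ ⟨g, -, rfl⟩; exact ⟨g, rfl⟩
  obtain ⟨E', hE'⟩ : ∃ E' : ModularForm (Gamma1 N) ((p - 1 : ℕ) : ℤ),
      (⇑E' : ℍ → ℂ) = ⇑(ModularForm.E hp) :=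
    ⟨{ toFun := ⇑(ModularForm.E hp)
       slash_action_eq' := fun γ hγ ↦
         SlashInvariantFormClass.slash_action_eq (ModularForm.E hp) γ (hle hγ)
       holo' := (ModularForm.E hp).holo'
       bdd_at_cusps' := fun hc' ↦ (ModularForm.E hp).bdd_at_cusps' (hc'.mono hle) }, rfl⟩
  rw [← hE']
  induction I with
  | zero =>
    obtain ⟨F, hF⟩ := hc 0
    exact ⟨F, by simp [hF]⟩
  | succ I ih =>
    obtain ⟨T, hT⟩ := ih
    obtain ⟨F, hF⟩ := hc (I + 1)
    have hw : k + (I : ℤ) * ((p - 1 : ℕ) : ℤ) + ((p - 1 : ℕ) : ℤ) =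
        k + ((I + 1 : ℕ) : ℤ) * ((p - 1 : ℕ) : ℤ) := by push_cast; ring
    refine ⟨ModularForm.mcast hw (T.mul E') + F, ?_⟩
    rw [ModularForm.coe_add, ModularForm.qExpansion_add one_pos hΓ, ModularForm.qExpansion_mcast,
      ModularForm.qExpansion_mul one_pos hΓ, hT, ← hF, Finset.sum_range_succ _ (I + 1),
      Nat.sub_self, pow_zero, mul_one, Finset.sum_mul]
    congr 1
    refine Finset.sum_congr rfl fun i hi ↦ ?_
    rw [Finset.mem_range] at hi
    rw [mul_assoc, ← pow_succ, Nat.sub_add_comm (Nat.lt_succ_iff.mp hi)]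

/-- `Δ · T` for a modular form `T` of weight `k` on `Γ₁(N)` is a cusp form of weight `12 + k` on
`Γ₁(N)` whose `q`-expansion is the product of the `q`-expansions (`Δ` restricted from level
one; Mathlib `CuspForm.mulModularForm`, `ModularForm.qExpansion_mul_coe`). [folklore] -/
theorem exists_cuspForm_discriminant_mul {k : ℤ} (T : ModularForm (Gamma1 N) k) :
    ∃ G : CuspForm (Gamma1 N) (12 + k),
      qExpansion 1 ⇑G = qExpansion 1 ModularForm.discriminant * qExpansion 1 ⇑T := by
  have hle : (Gamma1 N : Subgroup (GL (Fin 2) ℝ)) ≤ 𝒮ℒ := by rintro _ ⟨g, -, rfl⟩; exact ⟨g, rfl⟩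
  have hΓ : (1 : ℝ) ∈ (Gamma1 N : Subgroup (GL (Fin 2) ℝ)).strictPeriods := by simp
  let Δ' : CuspForm (Gamma1 N) 12 :=
    { toFun := ⇑CuspForm.discriminant
      slash_action_eq' := fun γ hγ ↦
        SlashInvariantFormClass.slash_action_eq CuspForm.discriminant γ (hle hγ)
      holo' := CuspForm.discriminant.holo'
      zero_at_cusps' := fun hc ↦ CuspForm.discriminant.zero_at_cusps' (hc.mono hle) }
  refine ⟨Δ'.mulModularForm T, ?_⟩
  rw [CuspForm.coe_mulModularForm, ModularForm.qExpansion_mul_coe one_pos hΓ Δ' T]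
  rfl

end ModularForms

/-- **K1 — the Katz–Sturm `p`-adic gain ("Sturm's bound is the `p`-adic capacity").** A complex
`q`-series `F = ∑ᵢ cᵢ E_{p-1}^{-i}` (coefficientwise along `ι⁻¹ : ℂ ≃ ℚ̄_p`) carrying a Katz datum
of weight `w`, rate `r > 0`, constant `C ≥ 0` on `Γ₁(N)` (`cᵢ` the `q`-expansion of a classical form
of weight `w + i(p-1)`, `‖ι⁻¹ aₙ(cᵢ)‖ ≤ C p^{-ri}`) and vanishing below order `M` has
`‖ι⁻¹ a_M(F)‖ ≤ C · p^{(r/(p-1))(w + 12 - 12(M+1)/μ)}`, `μ = [SL₂(ℤ) : Γ₁(N)]`, granted the sup-norm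
Sturm bound `hSup` along `ι` for cusp forms on `Γ₁(N)` (Δ-trick, Katz truncation at the last
weight below the Sturm line, `p`-integrality of `E_{p-1}`). [folklore] -/
theorem stub_katzSturm (p : ℕ) [Fact p.Prime] (hp : 5 ≤ p) (N : ℕ) [NeZero N]
    (ι : PadicAlgCl p ≃+* ℂ)
    (hSup : ∀ (W : ℤ) (G : CuspForm (CongruenceSubgroup.Gamma1 N) W) (ε : ℝ), 0 ≤ ε →
      (∀ m : ℕ, m ≤ (W * ((CongruenceSubgroup.Gamma1 N).index : ℤ)).toNat / 12 →
        ‖ι.symm (coeff m (qExpansion 1 ⇑G))‖ ≤ ε) →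
      ∀ m : ℕ, ‖ι.symm (coeff m (qExpansion 1 ⇑G))‖ ≤ ε)
    (w : ℤ) (r C : ℝ) (hr : 0 < r) (hC : 0 ≤ C) (c : ℕ → PowerSeries ℂ) (F : PowerSeries ℂ)
    (hc₁ : ∀ i : ℕ, ∃ G : ModularForm (CongruenceSubgroup.Gamma1 N) (w + i * (p - 1 : ℕ)),
      c i = qExpansion 1 ⇑G)
    (hc₂ : ∀ i n : ℕ, ‖ι.symm (coeff n (c i))‖ ≤ C * (p : ℝ) ^ (-(r * i)))
    (hc₃ : ∀ n : ℕ, HasSum (fun i : ℕ ↦ ι.symm (coeff n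
      (c i * ((qExpansion 1 ⇑(ModularForm.E (show 3 ≤ p - 1 by omega)))⁻¹) ^ i)))
      (ι.symm (coeff n F)))
    (M : ℕ) (hM : ∀ m, m < M → coeff m F = 0) :
    ‖ι.symm (coeff M F)‖ ≤ C * (p : ℝ) ^ (r / ((p : ℝ) - 1) *
      ((w : ℝ) + 12 - 12 * ((M : ℝ) + 1) / ((CongruenceSubgroup.Gamma1 N).index : ℝ))) := by
  classical
  /- § notation and elementary facts -/
  have hprime : p.Prime := Fact.out
  have hd3 : 3 ≤ p - 1 := by omega
  set μ : ℕ := (CongruenceSubgroup.Gamma1 N).index with hμdef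
  have hμ0 : μ ≠ 0 := Subgroup.FiniteIndex.index_ne_zero
  have hμpos : (0 : ℝ) < μ := Nat.cast_pos.mpr (Nat.pos_of_ne_zero hμ0)
  have hp1 : (1 : ℝ) < p := by exact_mod_cast hprime.one_lt
  have hdcast : ((p - 1 : ℕ) : ℝ) = (p : ℝ) - 1 := by
    rw [Nat.cast_sub hprime.one_lt.le, Nat.cast_one]
  -- transport along `ι⁻¹`
  set f : ℂ →+* PadicAlgCl p := ι.symm.toRingHom with hfdef
  have hf : ∀ (Q : PowerSeries ℂ) (n : ℕ), ι.symm (coeff n Q) = coeff n (Q.map f) := fun Q n ↦ by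
    rw [coeff_map]
    rfl
  /- § the Eisenstein series `E_{p-1}`: integral, constant term `1` -/
  set Eq : PowerSeries ℂ := qExpansion 1 ⇑(ModularForm.E hd3) with hEqdef
  have hE0 : constantCoeff Eq = 1 := by
    rw [← coeff_zero_eq_constantCoeff_apply]
    exact EisensteinSeries.E_qExpansion_coeff_zero hd3 (hprime.even_sub_one (by omega))
  have hE0' : constantCoeff Eq ≠ 0 := by rw [hE0]; exact one_ne_zero
  obtain ⟨e, he_def⟩ : ∃ e : PowerSeries (PadicAlgCl p), e = Eq.map f := ⟨_, rfl⟩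
  have he0 : constantCoeff e = 1 := by
    rw [← coeff_zero_eq_constantCoeff_apply, he_def, coeff_map, coeff_zero_eq_constantCoeff_apply,
      hE0, map_one]
  have he : ∀ n, ‖coeff n e‖ ≤ 1 := fun n ↦ by
    rw [he_def, ← hf]
    exact stub_eisensteinCoeff p hp ι n
  have heinv : Eq⁻¹.map f = e⁻¹ := by
    rw [PowerSeries.eq_inv_iff_mul_eq_one (by rw [he0]; exact one_ne_zero), he_def, ← map_mul,
      PowerSeries.inv_mul_cancel _ hE0', map_one]
  /- § the datum, read in `ℚ̄_p⟦q⟧` -/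
  obtain ⟨a, ha_def⟩ : ∃ a : ℕ → PowerSeries (PadicAlgCl p), ∀ i, a i = (c i).map f :=
    ⟨_, fun _ ↦ rfl⟩
  obtain ⟨G, hG_def⟩ : ∃ G : PowerSeries (PadicAlgCl p), G = F.map f := ⟨_, rfl⟩
  obtain ⟨B, hB_def⟩ : ∃ B : ℕ → ℝ, ∀ i, B i = C * (p : ℝ) ^ (-(r * i)) := ⟨_, fun _ ↦ rfl⟩
  have hB0 : ∀ i, 0 ≤ B i := fun i ↦ by
    rw [hB_def]
    exact mul_nonneg hC (Real.rpow_nonneg (Nat.cast_nonneg p) _)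
  have hBanti : Antitone B := by
    intro i j hij
    rw [hB_def, hB_def]
    refine mul_le_mul_of_nonneg_left (Real.rpow_le_rpow_of_exponent_le hp1.le ?_) hC
    have : (i : ℝ) ≤ j := Nat.cast_le.mpr hij
    nlinarith
  have ha : ∀ i n, ‖coeff n (a i)‖ ≤ B i := fun i n ↦ by
    rw [ha_def, hB_def, ← hf]
    exact hc₂ i n
  have hG : ∀ n, HasSum (fun i ↦ coeff n (a i * e⁻¹ ^ i)) (coeff n G) := by
    intro n
    have h := hc₃ n
    simp only [hf, map_mul, map_pow, heinv, ← ha_def, ← hG_def] at h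
    exact h
  have hGM : ∀ m, m < M → coeff m G = 0 := fun m hm ↦ by
    rw [hG_def, coeff_map, hM m hm, map_zero]
  /- § the discriminant: integral, `Δ = q + O(q²)` -/
  obtain ⟨δ, hδ_def⟩ : ∃ δ : PowerSeries (PadicAlgCl p),
      δ = (qExpansion 1 ModularForm.discriminant).map f := ⟨_, rfl⟩
  have hδZ : ∀ n, coeff n δ = ((coeff n (X * formalDeltaUnit) : ℤ) : PadicAlgCl p) := fun n ↦ by
    rw [hδ_def, coeff_map, qExpansion_discriminant, coeff_map, eq_intCast, map_intCast]
  have hδ : ∀ n, ‖coeff n δ‖ ≤ 1 := fun n ↦ by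
    rw [hδZ]
    exact IsUltrametricDist.norm_intCast_le_one _ _
  have hδ0 : coeff 0 δ = 0 := by rw [hδZ, coeff_zero_X_mul, Int.cast_zero]
  have hδ1 : coeff 1 δ = 1 := by
    rw [hδZ, ← pow_one (X : PowerSeries ℤ), coeff_X_pow_mul', if_pos le_rfl, Nat.sub_self,
      coeff_zero_eq_constantCoeff_apply, constantCoeff_formalDeltaUnit, Int.cast_one]
  /- § the least `J` on or beyond the Sturm line -/
  have hex : ∃ J : ℕ, 12 * ((M : ℤ) + 1) ≤ (12 + (w + J * (p - 1 : ℕ))) * μ := by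
    refine ⟨12 * (M + 1) + w.natAbs, ?_⟩
    have h1 : (1 : ℤ) ≤ μ := by exact_mod_cast Nat.pos_of_ne_zero hμ0
    have h2 : (1 : ℤ) ≤ ((p - 1 : ℕ) : ℤ) := by omega
    have h3 : 12 * ((M : ℤ) + 1) ≤ w + ((12 * (M + 1) + w.natAbs : ℕ) : ℤ) := by omega
    have h4 : (0 : ℤ) ≤ ((12 * (M + 1) + w.natAbs : ℕ) : ℤ) := by positivity
    have h5 : 12 * ((M : ℤ) + 1) ≤
        12 + (w + ((12 * (M + 1) + w.natAbs : ℕ) : ℤ) * ((p - 1 : ℕ) : ℤ)) := by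
      have := mul_le_mul_of_nonneg_left h2 h4
      linarith
    calc 12 * ((M : ℤ) + 1)
        ≤ 12 + (w + ((12 * (M + 1) + w.natAbs : ℕ) : ℤ) * ((p - 1 : ℕ) : ℤ)) := h5
      _ ≤ (12 + (w + ((12 * (M + 1) + w.natAbs : ℕ) : ℤ) * ((p - 1 : ℕ) : ℤ))) * μ :=
          le_mul_of_one_le_right (by linarith) h1
  obtain ⟨J, hJ, hJmin⟩ : ∃ J : ℕ, 12 * ((M : ℤ) + 1) ≤ (12 + (w + J * (p - 1 : ℕ))) * μ ∧
      ∀ I, I < J → ¬ 12 * ((M : ℤ) + 1) ≤ (12 + (w + I * (p - 1 : ℕ))) * μ :=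
    ⟨Nat.find hex, Nat.find_spec hex, fun I hI ↦ Nat.find_min hex hI⟩
  /- § the gain: `‖a_M‖ ≤ C p^{-rJ}` -/
  have hmain : ‖coeff M G‖ ≤ B J := by
    rcases J with _ | I
    · exact norm_coeff_le_of_hasSum he0 he hB0 hBanti ha hG M
    have hnot := hJmin I I.lt_succ_self
    -- the classical truncation `G_I = Δ ∑_{i ≤ I} c_i E^{I-i}`, a cusp form of weight `w+12+I(p-1)`
    obtain ⟨T, hT⟩ := exists_modularForm_truncation hd3 w c hc₁ I
    obtain ⟨Gc, hGc⟩ := exists_cuspForm_discriminant_mul T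
    obtain ⟨hK1, hK2⟩ := katz_truncation he0 he hδ hδ0 hδ1 hB0 hBanti ha hG hGM I
    set S := ∑ i ∈ Finset.range (I + 1), a i * e ^ (I - i) with hS
    have hGcmap : (qExpansion 1 ⇑Gc).map f = δ * S := by
      rw [hGc, map_mul, hT, map_sum, hδ_def, hS]
      congr 1
      refine Finset.sum_congr rfl fun i _ ↦ ?_
      rw [map_mul, map_pow, ha_def, he_def]
    -- the Sturm line of weight `w + 12 + I(p-1)` lies at or below `M`
    have hSturm : ((12 + (w + I * (p - 1 : ℕ))) * (μ : ℤ)).toNat / 12 ≤ M := by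
      have hlt := not_le.mp hnot
      generalize (12 + (w + (I : ℤ) * ((p - 1 : ℕ) : ℤ))) * (μ : ℤ) = X at hlt ⊢
      omega
    have hall := hSup _ Gc (B (I + 1)) (hB0 _) (fun m hm ↦ by
      rw [hf, hGcmap]
      exact hK1 m (hm.trans hSturm)) (M + 1)
    rw [hf, hGcmap] at hall
    calc ‖coeff M G‖ = ‖coeff M G - coeff (M + 1) (δ * S) + coeff (M + 1) (δ * S)‖ := by
          rw [sub_add_cancel]
      _ ≤ max ‖coeff M G - coeff (M + 1) (δ * S)‖ ‖coeff (M + 1) (δ * S)‖ :=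
          IsUltrametricDist.norm_add_le_max _ _
      _ ≤ B (I + 1) := max_le hK2 hall
  /- § the exponent -/
  rw [hf, ← hG_def]
  refine hmain.trans ?_
  rw [hB_def]
  refine mul_le_mul_of_nonneg_left (Real.rpow_le_rpow_of_exponent_le hp1.le ?_) hC
  have hp1' : (0 : ℝ) < (p : ℝ) - 1 := by linarith
  have hJR : 12 * ((M : ℝ) + 1) ≤ (12 + ((w : ℝ) + (J : ℝ) * ((p : ℝ) - 1))) * (μ : ℝ) := by
    rw [← hdcast]
    exact_mod_cast hJ
  have h1 : 12 * ((M : ℝ) + 1) / (μ : ℝ) ≤ 12 + ((w : ℝ) + J * ((p : ℝ) - 1)) := by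
    rw [div_le_iff₀ hμpos]
    exact hJR
  have h2 : -(r * (J : ℝ)) =
      r / ((p : ℝ) - 1) * ((w : ℝ) + 12 - (12 + ((w : ℝ) + J * ((p : ℝ) - 1)))) := by
    field_simp
    ring
  rw [h2]
  exact mul_le_mul_of_nonneg_left (by linarith) (div_pos hr hp1').le

end Summit.Langlands.Langlands.Theorems.CapacityClassicality
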